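import Mathlib.CategoryTheory.EssentiallySmall
import Literature.AnabelianGeometry.SemiGraphs.GaloisCountableGraphs
import Literature.AnabelianGeometry.SemiGraphs.FibredSemiGraph
import Literature.AnabelianGeometry.Anabelioids.OverConnectedGalois
import Literature.AnabelianGeometry.Anabelioids.OverPullbackExact
import Literature.AnabelianGeometry.Anabelioids.OverStarExact
import Literature.AnabelianGeometry.Anabelioids.ComponentsOfObjects
import Literature.AnabelianGeometry.Anabelioids.GaloisEquivalence

/-!
# The finite étale covering `𝒢_A → 𝒢` attached to an object `A` of `B(𝒢)` ([SemiAnbd] Def. 2.2 (i))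

Mochizuki, *Semi-graphs of anabelioids*, Publ. RIMS **42** (2006) 221–322, §2 p. 23
[cite: MochizukiSemiAnbd2006, Def. 2.2(i) p.23]: given a finite étale covering `B' = B(𝒢)_{G'} → B(𝒢)`
of the anabelioid `B(𝒢)` of a semi-graph of anabelioids, "`B'` itself arises naturally as the
`B(−)` of some semi-graph of anabelioids `𝒢'` equipped with a morphism `𝒢' → 𝒢` … which lies over
some proper morphism of semi-graphs: the vertices (respectively, edges) of `𝔾'` that lie over a
vertex `v` (respectively, edge `e`) correspond to the connected components of `S_v` (respectively,
`T_e`); the constituent anabelioid at such a vertex is the component anabelioid `(𝒢_v)_P`", and a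
branch of an edge `(e, Q)` abuts to the vertex `(v, P)` for the component `P` of `S_v` under which `Q`
lies via the gluing isomorphism `ψ_b : b^* S_v ⥲ T_e`.

This file CONSTRUCTS that covering for an object `A = {S_v, T_e, ψ_b}` of `B(𝒢)` (brick B4 of the
existence half of Definition 2.2 (i); the verification that it satisfies the cell's rendering
`Hom.IsFiniteEtaleCoveringOf` of p. 23, hence the named fact `exists_finiteEtaleCovering`, is the
proof-only companion `CoveringOfObjectProofs.lean`):

* `BObj.branchImage`, `BObj.componentOver` — the subobject `ψ_b(b^* P) ⊆ T_e` and "the component of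
  `S_v` under which a component `Q ⊆ T_e` lies" (`Anabelioids.exists_connected_le_map_arrow`);
* `BObj.fibreData`, and the underlying semi-graph `𝔾_A := A.fibreData.total` (`FibredSemiGraph.lean`:
  vertices `Σ v, π₀(S_v)`, edges `Σ e, π₀(T_e)`, proper projection);
* the constituents: `u₁`-small models `Shrink (Over P)` of the component anabelioids `(𝒢_v)_P`,
  `(𝒢_e)_Q` (Galois by `galoisCategory_over` and transport), the gluing morphisms
  `(𝒢_e)_Q → (𝒢_v)_P` with pull-back functor `X ↦ b^* X ×_{b^* P} Q` (exact by
  `exact_overPost_comp_overPullback`, abc-iut-L3-t6), giving `BObj.coveringGraph A = 𝒢_A`;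
* the morphism `BObj.coveringHom A : 𝒢_A → 𝒢` over the projection, with vertex/edge components the
  finite étale morphisms `(𝒢_v)_P → 𝒢_v`, pull-back `Over.star P` (exact by
  `preservesFiniteColimits_overStar`), and the CANONICAL 2-isomorphisms `φ_b` from the explicit
  comparison `starPostIso : Over.star P ⋙ Over.post b^* ≅ b^* ⋙ Over.star (b^* P)` and Mathlib's
  `Over.starPullbackIsoStar` (canonicity matters: the global clause `B(𝒢_A) ≃ B(𝒢)_{/A}` is
  proved by computing with these 2-cells).

Universe bookkeeping: `π₀(S_v)` and `Over P` live in `max u₁ v₁`; they are finite, resp. `u₁`-small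
(`finite_connectedSubobject`, `small_over`), and are replaced by `Shrink`-copies in the universes `u`
of the semi-graph and `u₁` of the constituents, as the type of `exists_finiteEtaleCovering` demands.
-/

namespace Literature.AnabelianGeometry.SemiGraphs

open CategoryTheory CategoryTheory.Limits CategoryTheory.PreGaloisCategory
open Literature.AnabelianGeometry.Anabelioids

universe v₁ v₂ u₁ u₂ u

/-! ### Smallness of components and slices (instances) -/

section Instances

variable {C : Type u₁} [Category.{v₁} C] [GaloisCategory C]

/-- An object of a connected anabelioid has finitely many connected components.
[cite: MochizukiSemiAnbd2006, Def. 2.2(i) p.23] -/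
instance finite_π₀Obj (X : C) : Finite (π₀Obj X) := finite_connectedSubobject X

/-- The (finite) set of connected components is small in every universe.
[cite: MochizukiSemiAnbd2006, Def. 2.2(i) p.23] -/
instance small_π₀Obj (X : C) : Small.{u} (π₀Obj X) := inferInstance

/-- The component anabelioid `(𝒢_v)_P = Over P` is small in the universe of the constituents.
[cite: MochizukiSemiAnbd2006, Def. 2.2(i) p.23] -/
instance small_over' (P : C) : Small.{u₁} (Over P) := small_over P

end Instances

/-! ### The comparison `Over.star P ⋙ Over.post F ≅ F ⋙ Over.star (F P)`, explicitly -/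

section StarPost

variable {C : Type u₁} [Category.{v₁} C] {D : Type u₂} [Category.{v₂} D]
  [HasBinaryProducts C] [HasBinaryProducts D] (F : C ⥤ D)
  [PreservesLimitsOfShape (Discrete WalkingPair) F] (P : C)

set_option backward.isDefEq.respectTransparency false in
/-- The canonical comparison `F (P × X) ⥲ F P × F X` over `F P`, as a natural isomorphism
`Over.star P ⋙ Over.post F ≅ F ⋙ Over.star (F P)` (the EXPLICIT form of
`Anabelioids.nonempty_starPostIso`; its components are Mathlib's `PreservesLimitPair.iso`, so that
the 2-cells of the covering morphism are the canonical ones).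
[cite: MochizukiSemiAnbd2006, Def. 2.2(i) p.23] -/
noncomputable def starPostIso : Over.star P ⋙ Over.post F ≅ F ⋙ Over.star (F.obj P) :=
  NatIso.ofComponents
    (fun X => Over.isoMk (PreservesLimitPair.iso F P X) (by
      rw [PreservesLimitPair.iso_hom]
      change prodComparison F P X ≫ (prod.lift prod.fst (𝟙 _) ≫ prod.fst) =
        F.map (prod.lift prod.fst (𝟙 _) ≫ prod.fst)
      rw [prod.lift_fst, prod.lift_fst, prodComparison_fst]))
    (fun {X Y} g => by
      ext
      simp only [Functor.comp_map, Over.comp_left, Over.post_map,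
        Over.homMk_left, Over.isoMk_hom_left, Over.star_map_left, PreservesLimitPair.iso_hom]
      exact (prodComparison_natural F (𝟙 P) g).trans (by rw [F.map_id]))

/-- The components of `starPostIso` are the product comparison maps.
[cite: MochizukiSemiAnbd2006, Def. 2.2(i) p.23] -/
@[simp] theorem starPostIso_hom_app_left (X : C) :
    ((starPostIso F P).hom.app X).left = prodComparison F P X := by
  change (PreservesLimitPair.iso F P X).hom = _
  exact PreservesLimitPair.iso_hom F P X

end StarPost

namespace SemiGraphOfAnabelioids

namespace BObj

variable {𝒢 : SemiGraphOfAnabelioids.{v₁, u₁, u}} (A : 𝒢.BObj)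

/-! ### The component of `S_v` under a component of `T_e` -/

/-- `b^* P ↪ b^* S_v ⥲ T_e` is a monomorphism (`b^*` is left exact).
[cite: MochizukiSemiAnbd2006, Def. 2.2(i) p.23] -/
theorem mono_map_arrow_comp_ψ (b : 𝒢.graph.Branch) (v : 𝒢.graph.Vertex)
    (h : 𝒢.graph.abuts b = some v) (P : Subobject (A.S v)) :
    Mono ((𝒢.pull b v h).pullback.map P.arrow ≫ (A.ψ b v h).hom) := by
  haveI : PreservesFiniteLimits (𝒢.pull b v h).pullback := (𝒢.pull b v h).property.1
  exact mono_comp _ _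

/-- The subobject `ψ_b(b^* P) ⊆ T_e` determined by a subobject `P ⊆ S_v` and a branch `b` of `e`
abutting to `v`. [cite: MochizukiSemiAnbd2006, Def. 2.2(i) p.23] -/
noncomputable def branchImage (b : 𝒢.graph.Branch) (v : 𝒢.graph.Vertex)
    (h : 𝒢.graph.abuts b = some v) (P : Subobject (A.S v)) : Subobject (A.T (𝒢.graph.edgeOf b)) :=
  haveI := A.mono_map_arrow_comp_ψ b v h P
  Subobject.mk ((𝒢.pull b v h).pullback.map P.arrow ≫ (A.ψ b v h).hom)

/-- Every connected component `Q` of `T_e` lies under some connected component `P` of `S_v` via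
`ψ_b` ([SemiAnbd] p. 23). [cite: MochizukiSemiAnbd2006, Def. 2.2(i) p.23] -/
theorem exists_le_branchImage (b : 𝒢.graph.Branch) (v : 𝒢.graph.Vertex)
    (h : 𝒢.graph.abuts b = some v) (Q : π₀Obj (A.T (𝒢.graph.edgeOf b))) :
    ∃ P : π₀Obj (A.S v), Q.1 ≤ A.branchImage b v h P.1 := by
  haveI := Q.2
  haveI : PreservesFiniteLimits (𝒢.pull b v h).pullback := (𝒢.pull b v h).property.1
  haveI : PreservesFiniteColimits (𝒢.pull b v h).pullback := (𝒢.pull b v h).property.2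
  obtain ⟨P, hP, f, hf⟩ :=
    exists_connected_le_map_arrow (𝒢.pull b v h).pullback (A.ψ b v h) Q.1
  exact ⟨⟨P, hP⟩, Subobject.le_mk_of_comm f hf⟩

/-- **The component under**: the connected component of `S_v` under which the component `Q` of `T_e`
lies via `ψ_b` — the vertex to which the branch `(b, Q)` of `𝔾'` abuts ([SemiAnbd] p. 23).
[cite: MochizukiSemiAnbd2006, Def. 2.2(i) p.23] -/
noncomputable def componentOver (b : 𝒢.graph.Branch) (v : 𝒢.graph.Vertex)
    (h : 𝒢.graph.abuts b = some v) (Q : π₀Obj (A.T (𝒢.graph.edgeOf b))) : π₀Obj (A.S v) :=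
  Classical.choose (A.exists_le_branchImage b v h Q)

/-- `Q ⊆ ψ_b(b^* P)` for `P` the component under `Q`. [cite: MochizukiSemiAnbd2006, Def. 2.2(i) p.23] -/
theorem le_branchImage_componentOver (b : 𝒢.graph.Branch) (v : 𝒢.graph.Vertex)
    (h : 𝒢.graph.abuts b = some v) (Q : π₀Obj (A.T (𝒢.graph.edgeOf b))) :
    Q.1 ≤ A.branchImage b v h (A.componentOver b v h Q).1 :=
  Classical.choose_spec (A.exists_le_branchImage b v h Q)

/-! ### The underlying semi-graph `𝔾_A` -/

/-- The fibre data of `A`: components of `S_v` over `v`, of `T_e` over `e` (shrunk into the universe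
of the semi-graph), and "the component under" along each branch.
[cite: MochizukiSemiAnbd2006, Def. 2.2(i) p.23] -/
noncomputable def fibreData : 𝒢.graph.FibreData where
  FV v := Shrink.{u} (π₀Obj (A.S v))
  FE e := Shrink.{u} (π₀Obj (A.T e))
  σ b v h c := equivShrink _ (A.componentOver b v h ((equivShrink _).symm c))

/-- The component `P ⊆ S_v` named by a vertex `(v, P)` of `𝔾_A`.
[cite: MochizukiSemiAnbd2006, Def. 2.2(i) p.23] -/
noncomputable def vComp (vc : A.fibreData.total.Vertex) : π₀Obj (A.S (A.fibreData.proj.vertexMap vc)) :=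
  (equivShrink _).symm vc.2

/-- The component `Q ⊆ T_e` named by an edge `(e, Q)` of `𝔾_A`.
[cite: MochizukiSemiAnbd2006, Def. 2.2(i) p.23] -/
noncomputable def eComp (ec : A.fibreData.total.Edge) : π₀Obj (A.T (A.fibreData.proj.edgeMap ec)) :=
  (equivShrink _).symm ec.2

/-- The component `Q ⊆ T_e` named by a branch `(b, Q)` of `𝔾_A`, over the edge `e ∋ b` OF THE BRANCH
(definitionally `A.eComp (edgeOf (b, Q))`; this indexing keeps the gluing data over `𝒢.graph.edgeOf b`).
[cite: MochizukiSemiAnbd2006, Def. 2.2(i) p.23] -/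
noncomputable def brComp (bc : A.fibreData.total.Branch) :
    π₀Obj (A.T (𝒢.graph.edgeOf (A.fibreData.proj.branchMap bc))) :=
  (equivShrink _).symm bc.2

/-- `brComp (b, Q) = eComp (e, Q)` for `e` the edge of `b`. [cite: MochizukiSemiAnbd2006, Def. 2.2(i) p.23] -/
theorem eComp_edgeOf (bc : A.fibreData.total.Branch) :
    A.eComp (A.fibreData.total.edgeOf bc) = A.brComp bc := rfl

variable {A}

/-- A branch of `𝔾_A` abuts only over an abutting branch of `𝔾`.
[cite: MochizukiSemiAnbd2006, Def. 2.2(i) p.23] -/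
theorem abuts_fst {bc : A.fibreData.total.Branch} {vc : A.fibreData.total.Vertex}
    (h : A.fibreData.total.abuts bc = some vc) :
    𝒢.graph.abuts (A.fibreData.proj.branchMap bc) = some (A.fibreData.proj.vertexMap vc) :=
  A.fibreData.proj.abuts_branchMap bc vc h

/-- If the branch `(b, Q)` abuts to `(v, P)` then `P` is the component under `Q`.
[cite: MochizukiSemiAnbd2006, Def. 2.2(i) p.23] -/
theorem vComp_eq_componentOver {bc : A.fibreData.total.Branch} {vc : A.fibreData.total.Vertex}
    (h : A.fibreData.total.abuts bc = some vc) :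
    A.vComp vc = A.componentOver (A.fibreData.proj.branchMap bc) (A.fibreData.proj.vertexMap vc)
      (abuts_fst h) (A.brComp bc) := by
  obtain ⟨b, c⟩ := bc
  obtain ⟨v, p⟩ := vc
  change (𝒢.graph.abuts b).pbind _ = some _ at h
  cases hb : 𝒢.graph.abuts b with
  | none => simp [hb] at h
  | some w =>
    simp only [hb, Option.pbind_some, Option.some.injEq] at h
    obtain ⟨rfl, rfl⟩ := (Sigma.mk.inj_iff.mp h)
    exact (Equiv.symm_apply_apply _ _)

/-- If the branch `(b, Q)` abuts to `(v, P)` then `Q ⊆ ψ_b(b^* P)`.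
[cite: MochizukiSemiAnbd2006, Def. 2.2(i) p.23] -/
theorem brComp_le_branchImage {bc : A.fibreData.total.Branch} {vc : A.fibreData.total.Vertex}
    (h : A.fibreData.total.abuts bc = some vc) :
    (A.brComp bc).1 ≤ A.branchImage (A.fibreData.proj.branchMap bc) (A.fibreData.proj.vertexMap vc)
      (abuts_fst h) (A.vComp vc).1 := by
  rw [vComp_eq_componentOver h]
  exact A.le_branchImage_componentOver _ _ _ _

variable (A)

/-! ### The constituents and gluing morphisms of `𝒢_A` -/

/-- The inclusion `Q ↪ b^* P` of a subobject `Q ⊆ ψ_b(b^* P)` of `T_e`.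
[cite: MochizukiSemiAnbd2006, Def. 2.2(i) p.23] -/
noncomputable def inclOfLE {b : 𝒢.graph.Branch} {v : 𝒢.graph.Vertex} (h : 𝒢.graph.abuts b = some v)
    (P : Subobject (A.S v)) (Q : Subobject (A.T (𝒢.graph.edgeOf b))) (hle : Q ≤ A.branchImage b v h P) :
    (Q : 𝒢.E (𝒢.graph.edgeOf b)) ⟶ (𝒢.pull b v h).pullback.obj (P : 𝒢.V v) :=
  haveI := A.mono_map_arrow_comp_ψ b v h P
  Q.ofLE _ hle ≫ (Subobject.underlyingIso _).hom

/-- The inclusion `Q ↪ b^* P` is a monomorphism. [cite: MochizukiSemiAnbd2006, Def. 2.2(i) p.23] -/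
instance mono_inclOfLE {b : 𝒢.graph.Branch} {v : 𝒢.graph.Vertex} (h : 𝒢.graph.abuts b = some v)
    (P : Subobject (A.S v)) (Q : Subobject (A.T (𝒢.graph.edgeOf b)))
    (hle : Q ≤ A.branchImage b v h P) : Mono (A.inclOfLE h P Q hle) := by
  unfold inclOfLE
  exact mono_comp _ _

/-- `Q ↪ b^* P ↪ b^* S_v ⥲ T_e` is the inclusion of `Q`. [cite: MochizukiSemiAnbd2006, Def. 2.2(i) p.23] -/
theorem inclOfLE_comp {b : 𝒢.graph.Branch} {v : 𝒢.graph.Vertex} (h : 𝒢.graph.abuts b = some v)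
    (P : Subobject (A.S v)) (Q : Subobject (A.T (𝒢.graph.edgeOf b)))
    (hle : Q ≤ A.branchImage b v h P) :
    A.inclOfLE h P Q hle ≫ (𝒢.pull b v h).pullback.map P.arrow ≫ (A.ψ b v h).hom = Q.arrow := by
  haveI := A.mono_map_arrow_comp_ψ b v h P
  calc A.inclOfLE h P Q hle ≫ (𝒢.pull b v h).pullback.map P.arrow ≫ (A.ψ b v h).hom
      = Q.ofLE _ hle ≫ ((Subobject.underlyingIso _).hom ≫
          ((𝒢.pull b v h).pullback.map P.arrow ≫ (A.ψ b v h).hom)) := Category.assoc _ _ _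
    _ = Q.ofLE _ hle ≫ (A.branchImage b v h P).arrow := by
          congr 1
          exact Subobject.underlyingIso_hom_comp_eq_mk _
    _ = Q.arrow := Subobject.ofLE_arrow hle

/-- The constituent of `𝒢_A` at the vertex `(v, P)`: a model, in the universe of the constituents,
of the component anabelioid `(𝒢_v)_P = Over P`. [cite: MochizukiSemiAnbd2006, Def. 2.2(i) p.23] -/
abbrev VModel (vc : A.fibreData.total.Vertex) : Type u₁ :=
  Shrink.{u₁} (Over ((A.vComp vc).1 : 𝒢.V (A.fibreData.proj.vertexMap vc)))

/-- The constituent of `𝒢_A` at the edge `(e, Q)`: a model of the component anabelioid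
`(𝒢_e)_Q = Over Q`. [cite: MochizukiSemiAnbd2006, Def. 2.2(i) p.23] -/
abbrev EModel (ec : A.fibreData.total.Edge) : Type u₁ :=
  Shrink.{u₁} (Over ((A.eComp ec).1 : 𝒢.E (A.fibreData.proj.edgeMap ec)))

/-- The constituent `(𝒢_v)_P` (model) is a connected anabelioid.
[cite: MochizukiSemiAnbd2006, Def. 2.2(i) p.23] -/
theorem galoisCategory_vModel (vc : A.fibreData.total.Vertex) : GaloisCategory (A.VModel vc) := by
  haveI := (A.vComp vc).2
  haveI := galoisCategory_over ((A.vComp vc).1 : 𝒢.V (A.fibreData.proj.vertexMap vc))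
  exact galoisCategory_of_equivalence
    (Shrink.equivalence (Over ((A.vComp vc).1 : 𝒢.V (A.fibreData.proj.vertexMap vc))))

/-- The constituent `(𝒢_e)_Q` (model) is a connected anabelioid.
[cite: MochizukiSemiAnbd2006, Def. 2.2(i) p.23] -/
theorem galoisCategory_eModel (ec : A.fibreData.total.Edge) : GaloisCategory (A.EModel ec) := by
  haveI := (A.eComp ec).2
  haveI := galoisCategory_over ((A.eComp ec).1 : 𝒢.E (A.fibreData.proj.edgeMap ec))
  exact galoisCategory_of_equivalence
    (Shrink.equivalence (Over ((A.eComp ec).1 : 𝒢.E (A.fibreData.proj.edgeMap ec))))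

/-- The gluing functor `(𝒢_v)_P ⥤ (𝒢_e)_Q`, `X ↦ b^* X ×_{b^* P} Q` (on `Over`).
[cite: MochizukiSemiAnbd2006, Def. 2.2(i) p.23] -/
noncomputable abbrev gluingFunctor {b : 𝒢.graph.Branch} {v : 𝒢.graph.Vertex}
    (h : 𝒢.graph.abuts b = some v) (P : Subobject (A.S v)) (Q : Subobject (A.T (𝒢.graph.edgeOf b)))
    (hle : Q ≤ A.branchImage b v h P) :
    Over (P : 𝒢.V v) ⥤ Over (Q : 𝒢.E (𝒢.graph.edgeOf b)) :=
  Over.post (𝒢.pull b v h).pullback ⋙ Over.pullback (A.inclOfLE h P Q hle)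

/-- The gluing morphism of anabelioids `(𝒢_e)_Q → (𝒢_v)_P` of `𝒢_A` along the branch `(b, Q)` at
`(v, P)` (on the models): its pull-back functor is `X ↦ b^* X ×_{b^* P} Q`, exact by
`exact_overPost_comp_overPullback`. [cite: MochizukiSemiAnbd2006, Def. 2.2(i) p.23] -/
noncomputable def gluing {b : 𝒢.graph.Branch} {v : 𝒢.graph.Vertex} (h : 𝒢.graph.abuts b = some v)
    (P : π₀Obj (A.S v)) (Q : π₀Obj (A.T (𝒢.graph.edgeOf b))) (hle : Q.1 ≤ A.branchImage b v h P.1) :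
    Anabelioids.Hom (Shrink.{u₁} (Over (Q.1 : 𝒢.E (𝒢.graph.edgeOf b))))
      (Shrink.{u₁} (Over (P.1 : 𝒢.V v))) :=
  haveI : PreservesFiniteLimits (𝒢.pull b v h).pullback := (𝒢.pull b v h).property.1
  haveI : PreservesFiniteColimits (𝒢.pull b v h).pullback := (𝒢.pull b v h).property.2
  haveI : PreservesFiniteLimits (A.gluingFunctor h P.1 Q.1 hle) :=
    (exact_overPost_comp_overPullback (𝒢.pull b v h).pullback (P.1 : 𝒢.V v)
      (A.inclOfLE h P.1 Q.1 hle)).1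
  haveI : PreservesFiniteColimits (A.gluingFunctor h P.1 Q.1 hle) :=
    (exact_overPost_comp_overPullback (𝒢.pull b v h).pullback (P.1 : 𝒢.V v)
      (A.inclOfLE h P.1 Q.1 hle)).2
  haveI : PreservesFiniteLimits ((Shrink.equivalence (Over (P.1 : 𝒢.V v))).inverse ⋙
      A.gluingFunctor h P.1 Q.1 hle ⋙ (Shrink.equivalence (Over (Q.1 : 𝒢.E (𝒢.graph.edgeOf b)))).functor) :=
    ⟨fun _ _ _ => inferInstance⟩
  haveI : PreservesFiniteColimits ((Shrink.equivalence (Over (P.1 : 𝒢.V v))).inverse ⋙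
      A.gluingFunctor h P.1 Q.1 hle ⋙ (Shrink.equivalence (Over (Q.1 : 𝒢.E (𝒢.graph.edgeOf b)))).functor) :=
    ⟨fun _ _ _ => inferInstance⟩
  ExactFunctor.of ((Shrink.equivalence (Over (P.1 : 𝒢.V v))).inverse ⋙
      A.gluingFunctor h P.1 Q.1 hle ⋙ (Shrink.equivalence (Over (Q.1 : 𝒢.E (𝒢.graph.edgeOf b)))).functor)

/-- **The semi-graph of anabelioids `𝒢_A`** of an object `A` of `B(𝒢)` ([SemiAnbd] p. 23): underlying
semi-graph `𝔾_A` (components over components), constituents the component anabelioids `(𝒢_v)_P`,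
`(𝒢_e)_Q`, gluing morphisms `(𝒢_e)_Q → (𝒢_v)_P`, `X ↦ b^* X ×_{b^* P} Q`.
[cite: MochizukiSemiAnbd2006, Def. 2.2(i) p.23] -/
noncomputable def coveringGraph : SemiGraphOfAnabelioids.{v₁, u₁, u} where
  graph := A.fibreData.total
  V vc := A.VModel vc
  E ec := A.EModel ec
  galV vc := A.galoisCategory_vModel vc
  galE ec := A.galoisCategory_eModel ec
  pull bc vc h := A.gluing (abuts_fst h) (A.vComp vc) (A.brComp bc) (brComp_le_branchImage h)

/-! ### The morphism `𝒢_A → 𝒢` -/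

/-- The vertex component `(𝒢_v)_P → 𝒢_v` of `𝒢_A → 𝒢` (on the model): pull-back functor
`Over.star P`, "taking the product with `P`", exact by `preservesFiniteColimits_overStar`.
[cite: MochizukiSemiAnbd2006, Def. 2.2(i) p.23] -/
noncomputable def vertexHom (vc : A.fibreData.total.Vertex) :
    Anabelioids.Hom (A.VModel vc) (𝒢.V (A.fibreData.proj.vertexMap vc)) :=
  haveI := (A.vComp vc).2
  haveI := preservesFiniteColimits_overStar ((A.vComp vc).1 : 𝒢.V (A.fibreData.proj.vertexMap vc))
  haveI : PreservesFiniteLimits (Over.star ((A.vComp vc).1 : 𝒢.V (A.fibreData.proj.vertexMap vc)) ⋙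
      (Shrink.equivalence (Over ((A.vComp vc).1 : 𝒢.V (A.fibreData.proj.vertexMap vc)))).functor) :=
    ⟨fun _ _ _ => inferInstance⟩
  haveI : PreservesFiniteColimits (Over.star ((A.vComp vc).1 : 𝒢.V (A.fibreData.proj.vertexMap vc)) ⋙
      (Shrink.equivalence (Over ((A.vComp vc).1 : 𝒢.V (A.fibreData.proj.vertexMap vc)))).functor) :=
    ⟨fun _ _ _ => inferInstance⟩
  ExactFunctor.of (Over.star ((A.vComp vc).1 : 𝒢.V (A.fibreData.proj.vertexMap vc)) ⋙
    (Shrink.equivalence (Over ((A.vComp vc).1 : 𝒢.V (A.fibreData.proj.vertexMap vc)))).functor)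

/-- The edge component `(𝒢_e)_Q → 𝒢_e` of `𝒢_A → 𝒢` (on the model): pull-back functor `Over.star Q`.
[cite: MochizukiSemiAnbd2006, Def. 2.2(i) p.23] -/
noncomputable def edgeHom (ec : A.fibreData.total.Edge) :
    Anabelioids.Hom (A.EModel ec) (𝒢.E (A.fibreData.proj.edgeMap ec)) :=
  haveI := (A.eComp ec).2
  haveI := preservesFiniteColimits_overStar ((A.eComp ec).1 : 𝒢.E (A.fibreData.proj.edgeMap ec))
  haveI : PreservesFiniteLimits (Over.star ((A.eComp ec).1 : 𝒢.E (A.fibreData.proj.edgeMap ec)) ⋙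
      (Shrink.equivalence (Over ((A.eComp ec).1 : 𝒢.E (A.fibreData.proj.edgeMap ec)))).functor) :=
    ⟨fun _ _ _ => inferInstance⟩
  haveI : PreservesFiniteColimits (Over.star ((A.eComp ec).1 : 𝒢.E (A.fibreData.proj.edgeMap ec)) ⋙
      (Shrink.equivalence (Over ((A.eComp ec).1 : 𝒢.E (A.fibreData.proj.edgeMap ec)))).functor) :=
    ⟨fun _ _ _ => inferInstance⟩
  ExactFunctor.of (Over.star ((A.eComp ec).1 : 𝒢.E (A.fibreData.proj.edgeMap ec)) ⋙
    (Shrink.equivalence (Over ((A.eComp ec).1 : 𝒢.E (A.fibreData.proj.edgeMap ec)))).functor)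

/-- The edge component over an edge `f` *known* to equal the image edge (transport; needed because
`edgeOf (φ b') = φ (edgeOf b')` is only propositional in general).
[cite: MochizukiSemiAnbd2006, Def. 2.2(i) p.23] -/
noncomputable def edgeHomAt (ec : A.fibreData.total.Edge) (f : 𝒢.graph.Edge)
    (p : A.fibreData.proj.edgeMap ec = f) : Anabelioids.Hom (A.EModel ec) (𝒢.E f) := by
  subst p
  exact A.edgeHom ec

/-- `edgeHomAt` at the reflexive equality is `edgeHom`. [cite: MochizukiSemiAnbd2006, Def. 2.2(i) p.23] -/
@[simp] theorem edgeHomAt_rfl (ec : A.fibreData.total.Edge) :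
    A.edgeHomAt ec (A.fibreData.proj.edgeMap ec) rfl = A.edgeHom ec :=
  rfl

/-- `edgeHomAt` at the edge of a branch (`edgeOf (φ b) = φ (edgeOf b)` holds by `rfl` for the projection
of `𝔾_A`) is `edgeHom`. [cite: MochizukiSemiAnbd2006, Def. 2.2(i) p.23] -/
theorem edgeHomAt_edgeOf (bc : A.fibreData.total.Branch) :
    A.edgeHomAt (A.fibreData.total.edgeOf bc) (𝒢.graph.edgeOf (A.fibreData.proj.branchMap bc))
      (A.fibreData.proj.edgeOf_branchMap bc).symm = A.edgeHom (A.fibreData.total.edgeOf bc) :=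
  rfl

/-- The core of the 2-isomorphism `φ_b`: `Over.star P ⋙ (X ↦ b^* X ×_{b^* P} Q) ≅ b^* ⋙ Over.star Q`
(`P × X ↦ b^*(P × X) ×_{b^* P} Q ≅ b^* X × Q`). [cite: MochizukiSemiAnbd2006, Def. 2.2(i) p.23] -/
noncomputable def gluingStarIso {b : 𝒢.graph.Branch} {v : 𝒢.graph.Vertex}
    (h : 𝒢.graph.abuts b = some v) (P : Subobject (A.S v)) (Q : Subobject (A.T (𝒢.graph.edgeOf b)))
    (hle : Q ≤ A.branchImage b v h P) :
    Over.star (P : 𝒢.V v) ⋙ A.gluingFunctor h P Q hle ≅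
      (𝒢.pull b v h).pullback ⋙ Over.star (Q : 𝒢.E (𝒢.graph.edgeOf b)) :=
  haveI : PreservesFiniteLimits (𝒢.pull b v h).pullback := (𝒢.pull b v h).property.1
  Functor.isoWhiskerRight (starPostIso (𝒢.pull b v h).pullback (P : 𝒢.V v))
      (Over.pullback (A.inclOfLE h P Q hle)) ≪≫
    Functor.isoWhiskerLeft (𝒢.pull b v h).pullback (Over.starPullbackIsoStar (A.inclOfLE h P Q hle))

/-- The 2-isomorphism `φ_b` of `𝒢_A → 𝒢` at the branch `(b, Q)` abutting to `(v, P)`: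
`(P × −) then glue ≅ b^* then (Q × −)`, through the models.
[cite: MochizukiSemiAnbd2006, Def. 2.2(i) p.23] -/
noncomputable def twoIso (bc : A.fibreData.total.Branch) (vc : A.fibreData.total.Vertex)
    (h : A.fibreData.total.abuts bc = some vc) :
    (A.vertexHom vc).pullback ⋙ (A.coveringGraph.pull bc vc h).pullback ≅
      (𝒢.pull (A.fibreData.proj.branchMap bc) (A.fibreData.proj.vertexMap vc) (abuts_fst h)).pullback ⋙
        (A.edgeHomAt (A.fibreData.total.edgeOf bc) (𝒢.graph.edgeOf (A.fibreData.proj.branchMap bc))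
          (A.fibreData.proj.edgeOf_branchMap bc).symm).pullback :=
  let eP := Shrink.equivalence (Over ((A.vComp vc).1 : 𝒢.V (A.fibreData.proj.vertexMap vc)))
  let eQ := Shrink.equivalence
    (Over ((A.brComp bc).1 : 𝒢.E (𝒢.graph.edgeOf (A.fibreData.proj.branchMap bc))))
  let G := A.gluingFunctor (abuts_fst h) (A.vComp vc).1 (A.brComp bc).1 (brComp_le_branchImage h)
  show (Over.star _ ⋙ eP.functor) ⋙ (eP.inverse ⋙ G ⋙ eQ.functor) ≅
      (𝒢.pull (A.fibreData.proj.branchMap bc) (A.fibreData.proj.vertexMap vc) (abuts_fst h)).pullback ⋙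
        (Over.star _ ⋙ eQ.functor) from
    Functor.isoWhiskerLeft (Over.star _) (Functor.isoWhiskerRight eP.unitIso.symm (G ⋙ eQ.functor)) ≪≫
      Functor.isoWhiskerRight (A.gluingStarIso (abuts_fst h) (A.vComp vc).1 (A.brComp bc).1
        (brComp_le_branchImage h)) eQ.functor

/-- **The morphism `𝒢_A → 𝒢`** ([SemiAnbd] p. 23): over the projection `𝔾_A → 𝔾`, with components
the finite étale morphisms `(𝒢_v)_P → 𝒢_v`, `(𝒢_e)_Q → 𝒢_e` and the 2-isomorphisms `twoIso`.
[cite: MochizukiSemiAnbd2006, Def. 2.2(i) p.23] -/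
noncomputable def coveringHom : SemiGraphOfAnabelioids.Hom A.coveringGraph 𝒢 where
  base := A.fibreData.proj
  φV vc := A.vertexHom vc
  φE ec f p := A.edgeHomAt ec f p
  φB bc vc h := A.twoIso bc vc h

end BObj

end SemiGraphOfAnabelioids

end Literature.AnabelianGeometry.SemiGraphs
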